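import Summits.HodgeConjecture.HodgeConjecture.Theorems.SignSymmetricPowersGeneralPencil
import Literature.AlgebraicGeometry.HodgeTheory.HodgeGenericPointsComeagreQP
import Literature.Analysis.Complex.BranchedCoveringCharPolySCV
import HarnessLib

/-!
# Route `SignSymmetricPowers` — reading (a)-B «OFF-MEAGRE-B»: off ONE MEAGRE subset of the space of ι-even quinary
# forms of degree `d`, every smooth threefold `X = V(F) ⊂ ℙ⁴` carries the sign-deck clauses of crux K1-B and the Hodge
# conjecture holds on ALL self fibre powers of `X` (modulo Griffiths' holomorphy of the Hodge bundles in its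
# quasi-projective form and the keyed symmetric-`A₃` binder hN′; NO Cattani–Deligne–Kaplan)

Support file for crux K1-B `VeryGeneralSignCommutatorsInHg` (stmt-HodgeConjecture-19716; `--supports … --as helper`, nothing here
closes an item).  Prover seat `hodge-nonav-19716-p2` (g12, cell `hodge-nonav`), programme «OFF-MEAGRE-B» assigned by the route owner
hodge-nonav-p3 (g35, STATUS 2026-08-29T06:06:24Z): the route-B twin, ONE DIMENSION UP, of route A's booked rung-F-H1 reading (a)
`CyclicUnitaryPowersGenericCyclicSurfacePowersHodge.cyclicSurfacePowersHodge_offMeagre_of_griffiths1968` ∕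
`CyclicUnitaryPowersCyclicSurfacePowersHodgeOffMeagre.cyclicSurfacePowersHodge_offMeagre`, complementary to prover-Ax's reading
(a″)-B «PENCIL-B» (`SignSymmetricPowersGeneralPencil`: every Zariski-good pencil, all but COUNTABLY many members).

THE CHAIN (tree theorems; `Griffiths1968_holomorphicHodgeSubbundlesQP` and hN′ are HYPOTHESES, the latter DISCHARGED in §3 by the tree
theorem `WeightedPencil.symmetricA3NonCommutation_mono_holds`):
* (G)+(D) over the WHOLE base `S_{M_ι}` of `π = familyM ℂ 3 d M_ι` (smooth, irreducible, quasi-projective, total space quasi-projective):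
  `exists_isMeagre_algebraicMonodromyGroup_subset_mumfordTateGroup_of_griffiths1968QP` (this seat, `HodgeGenericPointsComeagreQP`:
  Griffiths QP ⇒ the non-Hodge-generic points are MEAGRE — Deligne 1972 Prop. 7.5 ∕ André 1992 Lemma 4 — and the PROVED Deligne (i)
  `deligne_finiteIndex_monodromy_le_mumfordTateGroup_of_isQuasiProjectiveOver`) ⇒ off a meagre `MS ⊆ S_{M_ι}(ℂ)`, `(Γ_t^Zar)⁰ ⊆ MT(H³(𝒴_t))`;
* (K) the pointwise kernel `SignSymmetricPowersPencilKernel.signModel_of_identityComponent_le_mumfordTate` (prover-Ax g15) at the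
  classifying point of `F`;
* (χ) the coefficient chart `S_{M_ι}(ℂ) ↪ ℂ^{M_ι}` is a topological embedding (`SignSymmetricPowersMeridianChart.isEmbedding_coeffChart`) with
  image the complement of the zero set of the restricted discriminant `D_{M_ι} = killHom Disc ≠ 0` (`range_coeffChart_eq`), so the image of
  `MS` is meagre (`Topology.IsInducing.isMeagre_image`) and `V(D_{M_ι})` is closed nowhere dense (`dense_setOf_eval_ne_zero`): the
  exceptional set `M = χ(MS) ∪ V(D_{M_ι})` is MEAGRE in `ℂ^{M_ι}`;
* (MT)+(P) model transfer along `X ≅ X_F` (`BettiUniverseIsoTransport`) and K2-B `SignSymmetricPowersClose.powersHodgeOfSignCommutators`.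

MAIN STATEMENTS: §1 `exists_isMeagre_identityComponent_le_mumfordTate_familyM_QP` (any `n`, `d ≥ 1`, `M`, degree `k`);
§2 `signThreefoldPowersHodge_offMeagre_QP` (leaf form, hypotheses `hGr`, `hNC`); §3 `signThreefoldPowersHodge_offMeagre_of_griffithsQP`
(hN′ discharged: CONDITIONAL on `Griffiths1968_holomorphicHodgeSubbundlesQP` ALONE — flips to unconditional by ONE application of the
cell's `griffiths1968_holomorphicHodgeSubbundlesQP_holds` when it lands) and `dense_compl_of_isMeagre_coeffs` (the exceptional set has dense
complement: the conclusion holds on a comeagre — dense, uncountable — set of ι-even forms for every even `d ≥ 4`).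

HONEST FRAMING: the exceptional set is MEAGRE (topologically negligible), not shown Lebesgue-null here and NOT a countable union of proper
Zariski-closed subsets — «very general in ℂ^{M_ι}» is item 19716 ∕ 19715 modulo hCDK (print input stmt-HodgeConjecture-23152), which stay
OPEN; rung F-H1 not moved; nothing here says HC ∕ HC_CM ∕ HC_AV is proved.

## References
* [Deligne1972WeilK3] P. Deligne, La conjecture de Weil pour les surfaces K3, Invent. Math. 15 (1972), Prop. 7.5.
* [Andre1992] Y. André, Mumford–Tate groups of mixed Hodge structures …, Compositio Math. 82 (1992), §4 Lemma 4, §5 Thm. 1.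
* [VoisinHodgeI2002] C. Voisin, Hodge Theory and Complex Algebraic Geometry I, §10.2.1 Thm. 10.3.
* [VoisinHodgeII2003] C. Voisin, Hodge Theory and Complex Algebraic Geometry II, §5.3.1 Lemma 5.13, §6.1.3, §6.2.1.
* [CarlsonMullerStachPeters2017] J. Carlson, S. Müller-Stach, C. Peters, Period Mappings and Period Domains, Def. 15.3.5, L.-D. 15.3.7.
* [CattaniDeligneKaplan1995] E. Cattani, P. Deligne, A. Kaplan, On the locus of Hodge classes, JAMS 8 (1995) — NOT used here.
-/

noncomputable section

set_option linter.dupNamespace false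
set_option maxHeartbeats 800000

namespace Summit.HodgeConjecture.HodgeConjecture.Theorems.SignSymmetricPowersSignThreefoldPowersHodgeOffMeagre

open scoped TensorProduct Topology
open CategoryTheory CategoryTheory.Limits AlgebraicGeometry Set
open _root_.Topology _root_.Filter
open Literature.AlgebraicGeometry.Motives Literature.AlgebraicGeometry.HodgeTheory
open Literature.AlgebraicGeometry.HodgeTheory.BettiUniverse
open Literature.AlgebraicGeometry.Motives.UniversalHypersurface Literature.AlgebraicGeometry.HodgeTheory.UniversalHypersurface
open Literature.AlgebraicGeometry.HodgeTheory.MonomialPencil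
open Literature.AlgebraicGeometry.FundamentalGroup
open Literature.AlgebraicTopology.SingularHomology
open Literature.AlgebraicGeometry.Motives.SmoothHypersurface (IsNonsingularForm)
open Summit.HodgeConjecture.HodgeConjecture.Theorems.SignSymmetricPowersConfluenceLinkG (isSupportedOn_of_coeff_odd_eq_zero)
open Summit.HodgeConjecture.HodgeConjecture.Theorems.SignSymmetricPowersFourFactsGeometricGenus (signDeckHodge_of_genusBound)
open Summit.HodgeConjecture.HodgeConjecture.Theorems.SmoothHypersurfaceGeometricGenus (stub_genusBoundThreefold)

/-! ### §1 Off a meagre subset of `S_M(ℂ)` the algebraic monodromy group of `familyM` lies in the Mumford–Tate group -/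

/-- **Deligne's «very general = off a meagre set» for the `M`-supported family, granted Griffiths (QP)**: for `d ≥ 1`, any
monomial set `M` with `S_M(ℂ) ≠ ∅`, Hodge-symmetric models `A` and a degree `k`, there is a MEAGRE `MS ⊆ S_M(ℂ)` such that at
every `t ∉ MS` the identity component `(Γ_t^Zar)⁰` of the monodromy group of `π_M = familyM ℂ n d M` (in degree `k`) lies in
`MT(Hᵏ(𝒴_t))` — `exists_isMeagre_algebraicMonodromyGroup_subset_mumfordTateGroup_of_griffiths1968QP` for `π_M` (base smooth of
relative dimension `#M`, irreducible, quasi-projective; total space quasi-projective). [cite: Deligne1972WeilK3, Prop. 7.5]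
[cite: CarlsonMullerStachPeters2017, Lemma–Definition 15.3.7] [cite: VoisinHodgeI2002, §10.2.1 Thm. 10.3] -/
theorem exists_isMeagre_identityComponent_le_mumfordTate_familyM_QP (hGr : Griffiths1968_holomorphicHodgeSubbundlesQP)
    [HodgeTensorFacts.{0, 0}] {n d : ℕ} (hd : 1 ≤ d) (M : Set (DegIndex n d)) [DecidablePred (· ∈ M)] (k : ℕ)
    (hu : IsSmoothProjectiveFamily (familyM ℂ n d M) n)
    (hU : IsCohomologicallyLocallyTrivialOn (familyM ℂ n d M) (univ : Set (ComplexPoints (baseM ℂ n d M))))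
    (A : ∀ t : ComplexPoints (baseM ℂ n d M), HodgeModel n (fiberOver (familyM ℂ n d M) t)) (hA : ∀ t, (A t).IsHodgeSymmetric)
    [hfin : ∀ t : ComplexPoints (baseM ℂ n d M), Module.Finite ℚ (bettiCohomology (fiberOver (familyM ℂ n d M) t) k)]
    (hne : Nonempty (ComplexPoints (baseM ℂ n d M))) :
    ∃ MS : Set (ComplexPoints (baseM ℂ n d M)), IsMeagre MS ∧
      ∀ t : ComplexPoints (baseM ℂ n d M), t ∉ MS →
        glIdentityComponent (ratMonodromyGroup (familyM ℂ n d M) k hU ⟨t, mem_univ _⟩) ⊆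
          (((A t).hodgeStructure (hu.isSmoothProjective t) (hA t) k).mumfordTateGroup :
            Set (bettiCohomology (fiberOver (familyM ℂ n d M) t) k ≃ₗ[ℚ] bettiCohomology (fiberOver (familyM ℂ n d M) t) k)) := by
  haveI := smoothOfRelativeDimension_baseM_hom ℂ n d M
  have hirr : IrreducibleSpace (baseM ℂ n d M).left := irreducibleSpace_baseM_left ℂ n d M ⟨hne.some.pt⟩
  obtain ⟨MS, hMS, h⟩ := exists_isMeagre_algebraicMonodromyGroup_subset_mumfordTateGroup_of_griffiths1968QP hGr
    (familyM ℂ n d M) n k (0 + Nat.card M) hu (isQuasiProjectiveOver_baseM n d M) (isQuasiProjectiveOver_totalM ℂ n d M (by omega))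
    hirr hU A hA
  exact ⟨MS, hMS, fun t ht => h ⟨t, mem_univ _⟩ ht⟩

/-! ### §2 The leaf off a meagre set of ι-even forms -/

/-- The zero set of a non-zero polynomial on `ℂ^ι` (`ι` finite) is MEAGRE: closed (continuity of evaluation) with dense complement
(`BranchedCoveringSCV.dense_setOf_eval_ne_zero`, identity principle), hence nowhere dense. [folklore] -/
theorem isMeagre_setOf_eval_eq_zero {ι : Type*} [Fintype ι] {D : MvPolynomial ι ℂ} (hD : D ≠ 0) :
    IsMeagre {a : ι → ℂ | MvPolynomial.eval a D = 0} := by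
  have hcl : IsClosed {a : ι → ℂ | MvPolynomial.eval a D = 0} := isClosed_eq (MvPolynomial.continuous_eval D) continuous_const
  refine (hcl.isNowhereDense_iff.2 ?_).isMeagre
  rw [interior_eq_empty_iff_dense_compl]
  have heq : {a : ι → ℂ | MvPolynomial.eval a D = 0}ᶜ = {a : ι → ℂ | MvPolynomial.eval a D ≠ 0} := by
    ext a; simp
  rw [heq]
  exact Literature.Analysis.Complex.BranchedCoveringSCV.dense_setOf_eval_ne_zero hD

/-- **Analytic K1-B, Cattani–Deligne–Kaplan-free: the sign-deck clauses and all σ-centraliser commutators in the Hodge group, off a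
MEAGRE set of ι-even forms** (granted Griffiths' theorem in QP form and hN′).  The statement of crux K1-B `VeryGeneralSignCommutatorsInHg`
— its `let`-block (`pmul2`, `fac`, `shn`, `Deck`, `Cen`, `Comm`) VERBATIM — with «off countably many proper Zariski-closed subsets of the space
of ι-even forms» replaced by «off a MEAGRE subset `M` of the coefficient space `ℂ^{M_ι}`» (Deligne 1972 Prop. 7.5 ∕ André 1992 Lemma 4): for
every even `d ≥ 4` and every ι-even homogeneous `f` of degree `d` with `M_ι`-coefficient vector off `M`, every smooth projective threefold
`X ⊂ ℙ⁴` cut out by `f` carries `σ : X ⟶ X` with `Deck d X hX σ ∧ Comm X hX σ`.  `M = χ(MS) ∪ V(D_{M_ι})` for the meagre set `MS` of §1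
(degree 3, the kernel's Hodge models) and the restricted discriminant `D_{M_ι}`; `σ` is `diagonalAut f` transported along `X ≅ X_f`.
CONDITIONAL on {Griffiths QP, hN′}; item 19716 itself (Zariski-very-general) untouched. [cite: Deligne1972WeilK3, Prop. 7.5]
[cite: Andre1992, §4 Lemma 4 and §5 Thm. 1] [cite: VoisinHodgeII2003, §6.1.3 and §6.2.1] [cite: CarlsonMullerStachPeters2017, Lemma–Definition 15.3.7]
[cite: VoisinHodgeI2002, §10.2.1 Thm. 10.3] -/
theorem exists_signDeck_comm_offMeagre_QP (hGr : Griffiths1968_holomorphicHodgeSubbundlesQP)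
    (hNC : ∀ (n d : ℕ) (f₁ g₀ g₂ : MvPolynomial (Fin (n + 2)) ℂ) (j k : Fin (n + 2)) (a : Fin (n + 2) → ℂˣ),
      1 ≤ n → 1 ≤ d → Odd n → (∃ (i : Fin (n + 2)) (c : ℂ), g₀ = c • MvPolynomial.X i ^ d) →
      f₁.IsHomogeneous d → g₀.IsHomogeneous d → g₂.IsHomogeneous d → IsSymmetricA3Datum f₁ g₀ g₂ j k a →
      ∀ (εa εb : ℝ) (ψ : ℂ → ℂ), IsSymmetricA3Bifurcation f₁ g₀ g₂ j a εa εb ψ →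
        ∃ εa' : ℝ, 0 < εa' ∧ εa' ≤ εa ∧ SymmetricA3NonCommutation n d f₁ g₀ g₂ ψ εa') :
    open Literature.AlgebraicGeometry.Motives Literature.AlgebraicGeometry.HodgeTheory Literature.AlgebraicGeometry.HodgeTheory.BettiUniverse CategoryTheory.Limits in let pmul2 : List (ℕ × ℕ) → List (ℕ × ℕ) → List (ℕ × ℕ) := fun a b => (List.range (a.length + b.length - 1)).map fun k => (((List.range (k + 1)).map fun i => (a.getD i (0, 0)).1 * (b.getD (k - i) (0, 0)).1 + (a.getD i (0, 0)).2 * (b.getD (k - i) (0, 0)).2).sum, ((List.range (k + 1)).map fun i => (a.getD i (0, 0)).1 * (b.getD (k - i) (0, 0)).2 + (a.getD i (0, 0)).2 * (b.getD (k - i) (0, 0)).1).sum); let fac : ℕ → Bool → List (ℕ × ℕ) := fun d odd => (List.range (d - 1)).map fun k => if odd ∧ ¬ Even k then (0, 1) else (1, 0); let shn : ℕ → ℕ → ℕ → ℕ := fun d j q => if (q + 1) * d < 5 then 0 else if j = 0 then (([fac d true, fac d false, fac d false, fac d false].foldl pmul2 (fac d true)).getD ((q + 1) * d - 5) (0, 0)).1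 else (([fac d true, fac d false, fac d false, fac d false].foldl pmul2 (fac d true)).getD ((q + 1) * d - 5) (0, 0)).2; let Deck : (d : ℕ) → (X : SchemeOver ℂ) → IsSmoothProjective 3 X → (X ⟶ X) → Prop := fun d X hX σ => pull σ 3 ^ 2 = 1 ∧ (∀ x y, tr hX (3 + 3) (cup X 3 3 (pull σ 3 x) (pull σ 3 y)) = tr hX (3 + 3) (cup X 3 3 x y)) ∧ ∀ j q : ℕ, j < 2 → q ≤ 3 → Module.finrank ℂ ↥(Module.End.eigenspace ((pull σ 3).baseChange ℂ) ((-1 : ℂ) ^ j) ⊓ (hodge exists_isReal_hodgeModel_holds hX 3).piece ((3 : ℤ) - q) q) = shn d j q; let Cen : (X : SchemeOver ℂ) → IsSmoothProjective 3 X → (X ⟶ X) → (bettiCohomology X 3 ≃ₗ[ℚ] bettiCohomology X 3) → Prop := fun X hX σ g => (∀ x, g (pull σ 3 x) = pull σ 3 (g x)) ∧ ∀ x y, tr hX (3 + 3) (cup X 3 3 (g x) (g y)) = tr hX (3 + 3) (cup X 3 3 x y); let Comm : (X : SchemeOver ℂ) → IsSmoothProjective 3 X → (X ⟶ X) → Prop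 := fun X hX σ => haveI := finite hX 3; haveI : HodgeTensorFacts.{0, 0} := hodgeTensorFacts_holds; ∀ g h : bettiCohomology X 3 ≃ₗ[ℚ] bettiCohomology X 3, Cen X hX σ g → Cen X hX σ h → g * h * g⁻¹ * h⁻¹ ∈ (hodge exists_isReal_hodgeModel_holds hX 3).hodgeGroup; ∀ ⦃d : ℕ⦄, Even d → 4 ≤ d → ∃ Mb : Set ({m : DegIndex 3 d | Even (m.1 0 + m.1 1)} → ℂ), IsMeagre Mb ∧ ∀ f : MvPolynomial (Fin 5) ℂ, f.IsHomogeneous d → (∀ e : Fin 5 →₀ ℕ, ¬ Even (e 0 + e 1) → f.coeff e = 0) → (fun m : {m : DegIndex 3 d | Even (m.1 0 + m.1 1)} => f.coeff m.1.1) ∉ Mb → ∀ ⦃X : SchemeOver ℂ⦄ (hX : IsSmoothProjective 3 X), IsHypersurfaceCutOutBy 4 f X → ∃ σ : X ⟶ X, Deck d X hX σ ∧ Comm X hX σ := by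
  intro pmul2 fac shn Deck Cen Comm d hd h4
  classical
  haveI hHTF : HodgeTensorFacts.{0, 0} := hodgeTensorFacts_holds
  -- ### (K) the pointwise kernel on the named family
  have hK := SignSymmetricPowersPencilKernel.signModel_of_identityComponent_le_mumfordTate
    (signDeckHodge_of_genusBound stub_genusBoundThreefold) affineHypersurfaceComplement_meridians_normalClosure_eq_top_holds
    discriminant_localBranches_nodal_holds hNC affineHypersurfaceComplement_meridian_isConj_holds
  obtain ⟨hu, hU, A, hA, hfin, t₀, hK⟩ := hK hd h4
  haveI : ∀ t : ComplexPoints (baseM ℂ 3 d {m : DegIndex 3 d | Even (m.1 0 + m.1 1)}),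
      Module.Finite ℚ (bettiCohomology (fiberOver (familyM ℂ 3 d {m : DegIndex 3 d | Even (m.1 0 + m.1 1)}) t) 3) := hfin
  -- ### (G)+(D) the meagre exceptional set of points of `S_{M_ι}(ℂ)`
  obtain ⟨MS, hMS, hΓ⟩ := exists_isMeagre_identityComponent_le_mumfordTate_familyM_QP hGr (by omega)
    {m : DegIndex 3 d | Even (m.1 0 + m.1 1)} 3 hu hU A hA ⟨t₀⟩
  -- ### (χ) the coefficient chart and the restricted discriminant
  obtain ⟨Disc, -, -, -, hV⟩ := exists_irreducible_isHomogeneous_discriminantForm (n := 3) (d := d) (by omega)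
  let χ : ComplexPoints (baseM ℂ 3 d {m : DegIndex 3 d | Even (m.1 0 + m.1 1)}) →
      ({m : DegIndex 3 d | Even (m.1 0 + m.1 1)} → ℂ) := fun t =>
    (coeffVector ℂ 3 d (AlgPoints.map (toBase ℂ 3 d {m : DegIndex 3 d | Even (m.1 0 + m.1 1)}) t)) ∘
      (Subtype.val : {m : DegIndex 3 d | Even (m.1 0 + m.1 1)} → DegIndex 3 d)
  have hχemb : IsEmbedding χ := SignSymmetricPowersMeridianChart.isEmbedding_coeffChart 3 d {m : DegIndex 3 d | Even (m.1 0 + m.1 1)}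
  have hrange : Set.range χ = {a | MvPolynomial.eval a (killHom ℂ 3 d {m : DegIndex 3 d | Even (m.1 0 + m.1 1)} Disc) ≠ 0} :=
    SignSymmetricPowersMeridianChart.range_coeffChart_eq 3 d {m : DegIndex 3 d | Even (m.1 0 + m.1 1)} hV
  have hχ : ∀ (t : ComplexPoints (baseM ℂ 3 d {m : DegIndex 3 d | Even (m.1 0 + m.1 1)}))
      (m : {m : DegIndex 3 d | Even (m.1 0 + m.1 1)}),
      χ t m = MvPolynomial.coeff m.1.1 (pointFormM ℂ 3 d _ t) := by
    intro t m
    change coeffVector ℂ 3 d (AlgPoints.map (toBase ℂ 3 d {m : DegIndex 3 d | Even (m.1 0 + m.1 1)}) t) m.1 = _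
    rw [coeffVector_apply]
  -- `D_{M_ι} ≠ 0`: it does not vanish at the chart of `t₀`
  have hDM : killHom ℂ 3 d {m : DegIndex 3 d | Even (m.1 0 + m.1 1)} Disc ≠ 0 := by
    intro h0
    have ht₀ : χ t₀ ∈ Set.range χ := ⟨t₀, rfl⟩
    rw [hrange, mem_setOf_eq, h0, map_zero] at ht₀
    exact ht₀ rfl
  -- ### the meagre exceptional set of coefficient vectors
  refine ⟨χ '' MS ∪ {a | MvPolynomial.eval a (killHom ℂ 3 d {m : DegIndex 3 d | Even (m.1 0 + m.1 1)} Disc) = 0},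
    (hχemb.isInducing.isMeagre_image hMS).union (isMeagre_setOf_eval_eq_zero hDM), ?_⟩
  intro F hF hev hFM X hX hcut
  rw [mem_union, not_or] at hFM
  obtain ⟨hF1, hF2⟩ := hFM
  have hMF : IsSupportedOn 3 d {m : DegIndex 3 d | Even (m.1 0 + m.1 1)} F := isSupportedOn_of_coeff_odd_eq_zero hev
  -- `F` is a nonsingular form: its coefficient vector lies in the image of the chart
  have hmem : (fun m : {m : DegIndex 3 d | Even (m.1 0 + m.1 1)} => F.coeff m.1.1) ∈ Set.range χ := by
    rw [hrange]
    exact hF2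
  have hJ : IsNonsingularForm ℂ F := by
    obtain ⟨t, ht⟩ := hmem
    have hvec : coeffVector ℂ 3 d (AlgPoints.map (toBase ℂ 3 d {m : DegIndex 3 d | Even (m.1 0 + m.1 1)}) t) =
        fun m : DegIndex 3 d => MvPolynomial.coeff m.1 F := by
      funext m
      by_cases hm : m ∈ {m : DegIndex 3 d | Even (m.1 0 + m.1 1)}
      · exact congrFun ht ⟨m, hm⟩
      · rw [coeffVector_map_toBase_of_not_mem ℂ 3 d {m : DegIndex 3 d | Even (m.1 0 + m.1 1)} t hm]
        exact (hev m.1 hm).symm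
    have hform : pointForm ℂ 3 d (AlgPoints.map (toBase ℂ 3 d {m : DegIndex 3 d | Even (m.1 0 + m.1 1)}) t) = F := by
      rw [← formOfCoeffs_coeffVector, hvec]
      exact formOfCoeffs_coeff F hF
    have h := isNonsingularForm_pointForm ℂ 3 d (AlgPoints.map (toBase ℂ 3 d {m : DegIndex 3 d | Even (m.1 0 + m.1 1)}) t)
    rwa [hform] at h
  obtain ⟨eX⟩ := hcut.nonempty_iso_hypersurface
  have hXF : IsSmoothProjective 3 (SmoothHypersurface.hypersurface F) := hX.of_iso eX
  have ha := signUnits_two_mem_diagonalStabilizer F hev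
  -- the classifying point of `F` lies off `MS`: its chart is the coefficient vector of `F`
  have hpt : χ (classifyingPoint ℂ 3 d {m : DegIndex 3 d | Even (m.1 0 + m.1 1)} t₀ F) =
      fun m : {m : DegIndex 3 d | Even (m.1 0 + m.1 1)} => F.coeff m.1.1 := by
    funext m
    rw [hχ, classifyingPoint_eq ℂ 3 d _ t₀ hF hJ hMF, pointFormM_pointOfFormM]
  have hoff : classifyingPoint ℂ 3 d {m : DegIndex 3 d | Even (m.1 0 + m.1 1)} t₀ F ∉ MS :=
    fun hin => hF1 ⟨_, hin, hpt⟩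
  -- ### (K) at the classifying point
  obtain ⟨⟨h1, h2, h3⟩, hComm⟩ := hK F hF hev hJ hXF ha (hΓ _ hoff)
  -- ### (MT) model transfer to `X` along `X ≅ X_F`
  exact ⟨eX.hom ≫ diagonalAut _ ha ≫ eX.inv, ⟨pull_conj_sq_eq_one_of_iso eX h1, tr_cup_pull_conj_of_iso hX hXF eX h2,
      fun j q hj hq => by
        rw [finrank_eigenspace_inf_piece_eq_of_iso exists_isReal_hodgeModel_holds hodgePQ_independent_of_hodgeModel_holds hX hXF
          eX (diagonalAut _ ha) 3]
        exact h3 j q hj hq⟩,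
    comm_of_iso exists_isReal_hodgeModel_holds hodgePQ_independent_of_hodgeModel_holds hX hXF eX (diagonalAut _ ha) 3 hComm⟩

/-- **HC on all powers of every smooth ι-even threefold off a MEAGRE set of forms** (modulo the quasi-projective form of Griffiths'
theorem and hN′; NO Cattani–Deligne–Kaplan).  For every even `d ≥ 4` there is a MEAGRE subset `M` of the coefficient space `ℂ^{M_ι}` of
ι-even quinary forms of degree `d` (`M_ι` = the monomials of even `x₀x₁`-degree) such that for every ι-even homogeneous `F` of degree `d`
with `M_ι`-coefficient vector off `M`, every smooth projective threefold `X ⊂ ℙ⁴` cut out by `F` and every `(k+1)`-fold self fibre power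
`Y` of `X`: `HodgeConjectureFor (3(k+1)) Y` — the rung-F-H1 leaf `SignThreefoldPowersHodge` with «off countably many proper
Zariski-closed subsets» replaced by «off a meagre set».  Proof: `exists_signDeck_comm_offMeagre_QP` + K2-B
`SignSymmetricPowersClose.powersHodgeOfSignCommutators` (PROVED).  CONDITIONAL on {Griffiths QP, hN′}.
[cite: Deligne1972WeilK3, Prop. 7.5] [cite: Andre1992, §4 Lemma 4 and §5 Thm. 1] [cite: VoisinHodgeII2003, §6.1.3 and §6.2.1]
[cite: CarlsonMullerStachPeters2017, Lemma–Definition 15.3.7] [cite: VoisinHodgeI2002, §10.2.1 Thm. 10.3] -/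
theorem signThreefoldPowersHodge_offMeagre_QP (hGr : Griffiths1968_holomorphicHodgeSubbundlesQP)
    (hNC : ∀ (n d : ℕ) (f₁ g₀ g₂ : MvPolynomial (Fin (n + 2)) ℂ) (j k : Fin (n + 2)) (a : Fin (n + 2) → ℂˣ),
      1 ≤ n → 1 ≤ d → Odd n → (∃ (i : Fin (n + 2)) (c : ℂ), g₀ = c • MvPolynomial.X i ^ d) →
      f₁.IsHomogeneous d → g₀.IsHomogeneous d → g₂.IsHomogeneous d → IsSymmetricA3Datum f₁ g₀ g₂ j k a →
      ∀ (εa εb : ℝ) (ψ : ℂ → ℂ), IsSymmetricA3Bifurcation f₁ g₀ g₂ j a εa εb ψ →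
        ∃ εa' : ℝ, 0 < εa' ∧ εa' ≤ εa ∧ SymmetricA3NonCommutation n d f₁ g₀ g₂ ψ εa') :
    ∀ ⦃d : ℕ⦄, Even d → 4 ≤ d →
      ∃ Mb : Set ({m : DegIndex 3 d | Even (m.1 0 + m.1 1)} → ℂ), IsMeagre Mb ∧
        ∀ F : MvPolynomial (Fin 5) ℂ, F.IsHomogeneous d → (∀ e : Fin 5 →₀ ℕ, ¬ Even (e 0 + e 1) → F.coeff e = 0) →
          (fun m : {m : DegIndex 3 d | Even (m.1 0 + m.1 1)} => F.coeff m.1.1) ∉ Mb →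
          ∀ ⦃X : SchemeOver ℂ⦄, IsSmoothProjective 3 X → IsHypersurfaceCutOutBy 4 F X →
            ∀ ⦃k : ℕ⦄ ⦃Y : SchemeOver ℂ⦄, (∃ π : Fin (k + 1) → (Y ⟶ X), Nonempty (IsLimit (Fan.mk Y π))) →
              HodgeConjectureFor (3 * (k + 1)) Y := by
  intro d hd h4
  obtain ⟨Mb, hMb, h⟩ := exists_signDeck_comm_offMeagre_QP hGr hNC hd h4
  exact ⟨Mb, hMb, fun F hF hev hFM X hX hcut k Y hY =>
    SignSymmetricPowersClose.powersHodgeOfSignCommutators hd h4 hX ⟨F, hF, hev, hcut⟩ (h F hF hev hFM hX hcut) hY⟩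

/-! ### §3 hN′ discharged: the leaf off a meagre set modulo Griffiths (QP) ONLY; density of the good set -/

/-- **Analytic K1-B modulo the QUASI-PROJECTIVE Griffiths theorem ONLY** (hN′ discharged by the tree theorem
`WeightedPencil.symmetricA3NonCommutation_mono_holds`): the `let`-block of crux K1-B verbatim, «very general» read as «off a MEAGRE set of
ι-even forms».  CONDITIONAL on `Griffiths1968_holomorphicHodgeSubbundlesQP` alone; item 19716 untouched; HC not proved.
[cite: Deligne1972WeilK3, Prop. 7.5] [cite: Andre1992, §4 Lemma 4 and §5 Thm. 1] [cite: VoisinHodgeI2002, §10.2.1 Thm. 10.3] -/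
theorem exists_signDeck_comm_offMeagre_of_griffithsQP (hGr : Griffiths1968_holomorphicHodgeSubbundlesQP) :
    open Literature.AlgebraicGeometry.Motives Literature.AlgebraicGeometry.HodgeTheory Literature.AlgebraicGeometry.HodgeTheory.BettiUniverse CategoryTheory.Limits in let pmul2 : List (ℕ × ℕ) → List (ℕ × ℕ) → List (ℕ × ℕ) := fun a b => (List.range (a.length + b.length - 1)).map fun k => (((List.range (k + 1)).map fun i => (a.getD i (0, 0)).1 * (b.getD (k - i) (0, 0)).1 + (a.getD i (0, 0)).2 * (b.getD (k - i) (0, 0)).2).sum, ((List.range (k + 1)).map fun i => (a.getD i (0, 0)).1 * (b.getD (k - i) (0, 0)).2 + (a.getD i (0, 0)).2 * (b.getD (k - i) (0, 0)).1).sum); let fac : ℕ → Bool → List (ℕ × ℕ) := fun d odd => (List.range (d - 1)).map fun k => if odd ∧ ¬ Even k then (0, 1) else (1, 0); let shn : ℕ → ℕ → ℕ → ℕ := fun d j q => if (q + 1) * d < 5 then 0 else if j = 0 then (([fac d true, fac d false, fac d false, fac d false].foldl pmul2 (fac d true)).getD ((q + 1) * d - 5) (0, 0)).1 else (([fac d true,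 fac d false, fac d false, fac d false].foldl pmul2 (fac d true)).getD ((q + 1) * d - 5) (0, 0)).2; let Deck : (d : ℕ) → (X : SchemeOver ℂ) → IsSmoothProjective 3 X → (X ⟶ X) → Prop := fun d X hX σ => pull σ 3 ^ 2 = 1 ∧ (∀ x y, tr hX (3 + 3) (cup X 3 3 (pull σ 3 x) (pull σ 3 y)) = tr hX (3 + 3) (cup X 3 3 x y)) ∧ ∀ j q : ℕ, j < 2 → q ≤ 3 → Module.finrank ℂ ↥(Module.End.eigenspace ((pull σ 3).baseChange ℂ) ((-1 : ℂ) ^ j) ⊓ (hodge exists_isReal_hodgeModel_holds hX 3).piece ((3 : ℤ) - q) q) = shn d j q; let Cen : (X : SchemeOver ℂ) → IsSmoothProjective 3 X → (X ⟶ X) → (bettiCohomology X 3 ≃ₗ[ℚ] bettiCohomology X 3) → Prop := fun X hX σ g => (∀ x, g (pull σ 3 x) = pull σ 3 (g x)) ∧ ∀ x y, tr hX (3 + 3) (cup X 3 3 (g x) (g y)) = tr hX (3 + 3) (cup X 3 3 x y); let Comm : (X : SchemeOver ℂ) → IsSmoothProjective 3 X → (X ⟶ X) → Prop := fun X hX σ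 => haveI := finite hX 3; haveI : HodgeTensorFacts.{0, 0} := hodgeTensorFacts_holds; ∀ g h : bettiCohomology X 3 ≃ₗ[ℚ] bettiCohomology X 3, Cen X hX σ g → Cen X hX σ h → g * h * g⁻¹ * h⁻¹ ∈ (hodge exists_isReal_hodgeModel_holds hX 3).hodgeGroup; ∀ ⦃d : ℕ⦄, Even d → 4 ≤ d → ∃ Mb : Set ({m : DegIndex 3 d | Even (m.1 0 + m.1 1)} → ℂ), IsMeagre Mb ∧ ∀ f : MvPolynomial (Fin 5) ℂ, f.IsHomogeneous d → (∀ e : Fin 5 →₀ ℕ, ¬ Even (e 0 + e 1) → f.coeff e = 0) → (fun m : {m : DegIndex 3 d | Even (m.1 0 + m.1 1)} => f.coeff m.1.1) ∉ Mb → ∀ ⦃X : SchemeOver ℂ⦄ (hX : IsSmoothProjective 3 X), IsHypersurfaceCutOutBy 4 f X → ∃ σ : X ⟶ X, Deck d X hX σ ∧ Comm X hX σ :=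
  exists_signDeck_comm_offMeagre_QP hGr Literature.AlgebraicGeometry.HodgeTheory.WeightedPencil.symmetricA3NonCommutation_mono_holds

/-- **Reading (a)-B modulo the QUASI-PROJECTIVE Griffiths theorem ONLY**: hN′ is the tree theorem
`WeightedPencil.symmetricA3NonCommutation_mono_holds` (seat 20241-p1 g19, through this seat's junction
`symmetricA3NonCommutation_mono_of_forall_circleTransport_not_unipotent`), so the leaf off a meagre set is CONDITIONAL on
`Griffiths1968_holomorphicHodgeSubbundlesQP` alone — the statement GRIFFITHS-HOLOMORPHY's `griffiths1968_holomorphicHodgeSubbundlesQP_holds`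
discharges by one application.  HC not proved; items 19716 ∕ 19715 untouched. [cite: Deligne1972WeilK3, Prop. 7.5]
[cite: VoisinHodgeI2002, §10.2.1 Thm. 10.3] [cite: VoisinHodgeII2003, §6.2.1] -/
theorem signThreefoldPowersHodge_offMeagre_of_griffithsQP (hGr : Griffiths1968_holomorphicHodgeSubbundlesQP) :
    ∀ ⦃d : ℕ⦄, Even d → 4 ≤ d →
      ∃ Mb : Set ({m : DegIndex 3 d | Even (m.1 0 + m.1 1)} → ℂ), IsMeagre Mb ∧
        ∀ F : MvPolynomial (Fin 5) ℂ, F.IsHomogeneous d → (∀ e : Fin 5 →₀ ℕ, ¬ Even (e 0 + e 1) → F.coeff e = 0) →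
          (fun m : {m : DegIndex 3 d | Even (m.1 0 + m.1 1)} => F.coeff m.1.1) ∉ Mb →
          ∀ ⦃X : SchemeOver ℂ⦄, IsSmoothProjective 3 X → IsHypersurfaceCutOutBy 4 F X →
            ∀ ⦃k : ℕ⦄ ⦃Y : SchemeOver ℂ⦄, (∃ π : Fin (k + 1) → (Y ⟶ X), Nonempty (IsLimit (Fan.mk Y π))) →
              HodgeConjectureFor (3 * (k + 1)) Y :=
  signThreefoldPowersHodge_offMeagre_QP hGr Literature.AlgebraicGeometry.HodgeTheory.WeightedPencil.symmetricA3NonCommutation_mono_holds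

/-- **The same modulo the ORIGINAL Griffiths fact** (monotonicity `griffiths1968QP_of_griffiths1968`). [cite: VoisinHodgeI2002, §10.2.1 Thm. 10.3] -/
theorem signThreefoldPowersHodge_offMeagre_of_griffiths (hGr : Griffiths1968_holomorphicHodgeSubbundles) :
    ∀ ⦃d : ℕ⦄, Even d → 4 ≤ d →
      ∃ Mb : Set ({m : DegIndex 3 d | Even (m.1 0 + m.1 1)} → ℂ), IsMeagre Mb ∧
        ∀ F : MvPolynomial (Fin 5) ℂ, F.IsHomogeneous d → (∀ e : Fin 5 →₀ ℕ, ¬ Even (e 0 + e 1) → F.coeff e = 0) →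
          (fun m : {m : DegIndex 3 d | Even (m.1 0 + m.1 1)} => F.coeff m.1.1) ∉ Mb →
          ∀ ⦃X : SchemeOver ℂ⦄, IsSmoothProjective 3 X → IsHypersurfaceCutOutBy 4 F X →
            ∀ ⦃k : ℕ⦄ ⦃Y : SchemeOver ℂ⦄, (∃ π : Fin (k + 1) → (Y ⟶ X), Nonempty (IsLimit (Fan.mk Y π))) →
              HodgeConjectureFor (3 * (k + 1)) Y :=
  signThreefoldPowersHodge_offMeagre_of_griffithsQP (griffiths1968QP_of_griffiths1968 hGr)

/-- **The exceptional set is small**: a meagre subset of the coefficient space `ℂ^{M_ι}` has DENSE complement (Baire), so the leaf's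
conclusion holds on a comeagre — dense, uncountable — set of ι-even forms for every even `d ≥ 4`. [folklore] -/
theorem dense_compl_of_isMeagre_coeffs {d : ℕ} {Mb : Set ({m : DegIndex 3 d | Even (m.1 0 + m.1 1)} → ℂ)} (hM : IsMeagre Mb) :
    Dense Mbᶜ :=
  dense_of_mem_residual hM

end Summit.HodgeConjecture.HodgeConjecture.Theorems.SignSymmetricPowersSignThreefoldPowersHodgeOffMeagre
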